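import Summits.CriticalPhenomena.SAWScalingLimit.Theorems.LeftRightFKG.Negative.BoxDomain
import Summits.CriticalPhenomena.SAWScalingLimit.Theorems.BoundaryTP2Negative_Box3

/-!
# Certified census of the 3 × 3 box (line `three-by-three-corner-witness`, stub `stub_boxCensus`)

Crux `stmt-CriticalPhenomena-11233`
(`Summit.CriticalPhenomena.SAWScalingLimit.Theses.SAWLeftRightFKG.NotFKGAtOne`, the negative guard of route
`SAWLeftRightFKG`: left–right positive association fails for the COUNTING measure), line
`three-by-three-corner-witness` (skeleton `Cruxes/NotFKGAtOne/Lines/three_by_three_corner_witness.lean`),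
registered stub `stub_boxCensus` — the COUNT side of the certificate.

**`stub_boxCensus`**: for ANY plane set `Ω` whose discrete domain graph at mesh `1` is `ℤ²` induced on the
box `{0,1,2}²` (the shape of the tree's `BoundaryTP2.Negative.adj₃_iff`), the self-avoiding chords
`(0,0) → (2,2)` number `12`; those with `1 ≤ wcross 0 0` (first step North) number `6`; those with
`1 ≤ wcross 1 1` (last step East) number `6`; and `2` have both (`Measure.count` on the `⊤` σ-algebra).

Proof: under the hypothesis the domain graph IS the tree's `Ω₃` box graph (`graph_eq_Ω₃`), so the landed
neighbour lister `nb₃` is complete and sound and chords have `≤ 8` steps; hence the support map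
`γ ↦ γ.walk.support` is a bijection onto the first-step enumeration
`(pathsFrom eqSite nb₃ 8 (0,0) []).filter (endsAt (2,2))` (landed `support_mem_pathsFrom`,
`exists_walk_of_mem_pathsFrom`, `walk_eq_of_support_eq`), the events read on supports
(`wcross m k γ.walk = pathCross m k (0,0) γ.walk.support.tail`, definitionally), `Measure.count = Set.encard`
(`Measure.count_apply`), and the four numbers are a kernel `decide` (`census₃`).  Generic tool:
`encard_eq_length_filter` (cardinality of an event through an injective, complete and sound list encoding).
Everything here is elementary ("folklore"); no definitions.
-/

noncomputable section

open scoped ENNReal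
open MeasureTheory Set Literature.Probability.LatticeModels Literature.Probability.RandomPlanarGeometry
open Summit.CriticalPhenomena.SAWScalingLimit.Theorems.LeftRightFKG.Negative (bx pathCross wcross)
open Summit.CriticalPhenomena.SAWScalingLimit.Theorems.BoundaryTP2.Negative
  (pathsFrom endsAt eqSite eqSite_iff nb₃ Ω₃ adj₃_iff mem_nb₃ nb₃_adj T₃ mem_T₃_iff card_T₃
   length_lt_card_of_adj_mem support_mem_pathsFrom exists_walk_of_mem_pathsFrom walk_eq_of_support_eq
   endsAt_support)

namespace Summit.CriticalPhenomena.SAWScalingLimit.Theorems.NotFKGAtOne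

/-! ## A generic counting tool -/

/-- **Cardinality through a certified list encoding.**  If `f : α → β` is injective, every `f a` is listed
in the duplicate-free list `L`, and every entry of `L` is some `f a`, then an event `S` read through `f` by
a Boolean test `p` has `encard` equal to the length of `L.filter p`. [folklore] -/
theorem encard_eq_length_filter {α β : Type*} [DecidableEq β] (f : α → β) (hf : Function.Injective f)
    (L : List β) (hL : L.Nodup) (hcomp : ∀ a, f a ∈ L) (hsound : ∀ b ∈ L, ∃ a, f a = b)
    (p : β → Bool) (S : Set α) (hS : ∀ a, a ∈ S ↔ p (f a) = true) :
    S.encard = ((L.filter p).length : ℕ∞) := by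
  have himg : f '' S = ↑(L.filter p).toFinset := by
    ext b
    simp only [Set.mem_image, List.coe_toFinset, Set.mem_setOf_eq, List.mem_filter]
    constructor
    · rintro ⟨a, ha, rfl⟩
      exact ⟨hcomp a, (hS a).1 ha⟩
    · rintro ⟨hb, hp⟩
      obtain ⟨a, rfl⟩ := hsound b hb
      exact ⟨a, (hS a).2 hp, rfl⟩
  rw [← hf.encard_image S, himg, Set.encard_coe_eq_coe_finsetCard,
    List.toFinset_card_of_nodup (hL.filter p)]

/-! ## The box graph: neighbour lister, length bound, enumeration of the chords -/

section Box

variable {Ω : Set ℂ}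

/-- Under the box-adjacency hypothesis the domain graph of `Ω` IS the tree's `Ω₃` box graph. [folklore] -/
theorem graph_eq_Ω₃ (hB : ∀ x y : Site 2, (discreteDomainGraph Ω 1).Adj x y ↔
      (zdGraph 2).Adj x y ∧ x ∈ boxSites ![0, 0] ![2, 2] ∧ y ∈ boxSites ![0, 0] ![2, 2]) :
    discreteDomainGraph Ω 1 = discreteDomainGraph Ω₃ 1 := by
  ext x y
  exact (hB x y).trans adj₃_iff.symm

/-- `nb₃` lists all neighbours of the domain graph of `Ω` (completeness). [folklore] -/
theorem mem_nb₃_of_adj (hB : ∀ x y : Site 2, (discreteDomainGraph Ω 1).Adj x y ↔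
      (zdGraph 2).Adj x y ∧ x ∈ boxSites ![0, 0] ![2, 2] ∧ y ∈ boxSites ![0, 0] ![2, 2])
    (u w : Site 2) (huw : (discreteDomainGraph Ω 1).Adj u w) : w ∈ nb₃ u := by
  rw [graph_eq_Ω₃ hB] at huw
  exact mem_nb₃ u w huw

/-- `nb₃` lists only neighbours of the domain graph of `Ω` (soundness). [folklore] -/
theorem adj_of_mem_nb₃ (hB : ∀ x y : Site 2, (discreteDomainGraph Ω 1).Adj x y ↔
      (zdGraph 2).Adj x y ∧ x ∈ boxSites ![0, 0] ![2, 2] ∧ y ∈ boxSites ![0, 0] ![2, 2])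
    (u w : Site 2) (hw : w ∈ nb₃ u) : (discreteDomainGraph Ω 1).Adj u w := by
  rw [graph_eq_Ω₃ hB]
  exact nb₃_adj u w hw

/-- Every chord `(0,0) → (2,2)` has at most `8` steps (nine vertices in the box). [folklore] -/
theorem length_le_eight_of_boxAdj (hB : ∀ x y : Site 2, (discreteDomainGraph Ω 1).Adj x y ↔
      (zdGraph 2).Adj x y ∧ x ∈ boxSites ![0, 0] ![2, 2] ∧ y ∈ boxSites ![0, 0] ![2, 2])
    (γ : SAW.DomainSAW Ω 1 (bx 0 0) (bx 2 2)) : γ.length ≤ 8 := by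
  have hT := length_lt_card_of_adj_mem (G := discreteDomainGraph Ω 1) T₃
    (fun x y hxy => ⟨(mem_T₃_iff x).2 ((hB x y).1 hxy).2.1, (mem_T₃_iff y).2 ((hB x y).1 hxy).2.2⟩)
    ((mem_T₃_iff (bx 0 0)).2 (by decide)) γ.walk γ.isPath
  have hc := card_T₃
  change γ.walk.length ≤ 8
  omega

/-- Completeness: the support of every chord is enumerated. [folklore] -/
theorem support_mem_enum (hB : ∀ x y : Site 2, (discreteDomainGraph Ω 1).Adj x y ↔
      (zdGraph 2).Adj x y ∧ x ∈ boxSites ![0, 0] ![2, 2] ∧ y ∈ boxSites ![0, 0] ![2, 2])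
    (γ : SAW.DomainSAW Ω 1 (bx 0 0) (bx 2 2)) :
    γ.walk.support ∈ (pathsFrom eqSite nb₃ 8 (bx 0 0) []).filter (endsAt eqSite (bx 2 2)) :=
  List.mem_filter.2 ⟨support_mem_pathsFrom eqSite_iff (mem_nb₃_of_adj hB) 8 γ.walk [] γ.isPath
    (length_le_eight_of_boxAdj hB γ) (by simp), endsAt_support eqSite_iff γ.walk⟩

/-- Soundness: every enumerated support is the support of a chord. [folklore] -/
theorem exists_chord_of_mem_enum (hB : ∀ x y : Site 2, (discreteDomainGraph Ω 1).Adj x y ↔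
      (zdGraph 2).Adj x y ∧ x ∈ boxSites ![0, 0] ![2, 2] ∧ y ∈ boxSites ![0, 0] ![2, 2])
    {s : List (Site 2)} (hs : s ∈ (pathsFrom eqSite nb₃ 8 (bx 0 0) []).filter (endsAt eqSite (bx 2 2))) :
    ∃ γ : SAW.DomainSAW Ω 1 (bx 0 0) (bx 2 2), γ.walk.support = s := by
  rw [List.mem_filter] at hs
  obtain ⟨v, p, hp, hsupp, -⟩ := exists_walk_of_mem_pathsFrom eqSite_iff (adj_of_mem_nb₃ hB) 8 [] s hs.1
  have hvb : v = bx 2 2 := by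
    have h1 := hs.2
    unfold endsAt at h1
    rw [← hsupp, List.getLast?_eq_some_getLast p.support_ne_nil, SimpleGraph.Walk.getLast_support] at h1
    exact (eqSite_iff v _).1 h1
  subst hvb
  exact ⟨⟨p, hp⟩, hsupp⟩

/-- A chord is determined by its support. [folklore] -/
theorem support_injective {a b : Site 2} :
    Function.Injective fun γ : SAW.DomainSAW Ω 1 a b => γ.walk.support := by
  intro γ γ' hγ
  have hw := walk_eq_of_support_eq γ.walk γ'.walk hγ
  cases γ; cases γ'
  simp only at hw
  subst hw
  rfl

end Box

/-! ## The kernel census and the four counts -/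

/-- **The census of the 3 × 3 box (kernel `decide`)**: the enumeration of the corner-to-corner supports is
duplicate-free and has 12 entries; 6 have `1 ≤ pathCross 0 0` (first step North), 6 have `1 ≤ pathCross 1 1`
(last step East), 2 have both. [folklore] -/
theorem census₃ :
    ((pathsFrom eqSite nb₃ 8 (bx 0 0) []).filter (endsAt eqSite (bx 2 2))).Nodup ∧
    (((pathsFrom eqSite nb₃ 8 (bx 0 0) []).filter (endsAt eqSite (bx 2 2))).filter
      fun _ => true).length = 12 ∧
    (((pathsFrom eqSite nb₃ 8 (bx 0 0) []).filter (endsAt eqSite (bx 2 2))).filter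
      fun s => decide (1 ≤ pathCross 0 0 (bx 0 0) s.tail)).length = 6 ∧
    (((pathsFrom eqSite nb₃ 8 (bx 0 0) []).filter (endsAt eqSite (bx 2 2))).filter
      fun s => decide (1 ≤ pathCross 1 1 (bx 0 0) s.tail)).length = 6 ∧
    (((pathsFrom eqSite nb₃ 8 (bx 0 0) []).filter (endsAt eqSite (bx 2 2))).filter
      fun s => decide (1 ≤ pathCross 0 0 (bx 0 0) s.tail) &&
        decide (1 ≤ pathCross 1 1 (bx 0 0) s.tail)).length = 2 := by
  decide

/-- `Measure.count` of an event of chords, through the certified enumeration: if the event reads `p` on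
supports and `p` selects `n` enumerated supports, the event has counting measure `n`. [folklore] -/
theorem count_eq_of_boxAdj {Ω : Set ℂ} (hB : ∀ x y : Site 2, (discreteDomainGraph Ω 1).Adj x y ↔
      (zdGraph 2).Adj x y ∧ x ∈ boxSites ![0, 0] ![2, 2] ∧ y ∈ boxSites ![0, 0] ![2, 2])
    (p : List (Site 2) → Bool) (S : Set (SAW.DomainSAW Ω 1 (bx 0 0) (bx 2 2)))
    (hS : ∀ γ, γ ∈ S ↔ p γ.walk.support = true) {n : ℕ}
    (hn : (((pathsFrom eqSite nb₃ 8 (bx 0 0) []).filter (endsAt eqSite (bx 2 2))).filter p).length = n) :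
    Measure.count S = (n : ℝ≥0∞) := by
  rw [Measure.count_apply MeasurableSpace.measurableSet_top,
    encard_eq_length_filter (fun γ : SAW.DomainSAW Ω 1 (bx 0 0) (bx 2 2) => γ.walk.support)
      support_injective _ census₃.1 (support_mem_enum hB) (fun s hs => exists_chord_of_mem_enum hB hs) p S hS,
    hn]
  exact ENat.toENNReal_coe n

/-- **STUB `stub_boxCensus` of line `three-by-three-corner-witness` (crux `NotFKGAtOne`).**  For ANY `Ω`
whose discrete domain graph at mesh `1` is `ℤ²` induced on the box `{0,1,2}²`, the chords `(0,0) → (2,2)`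
number `12`, those with `1 ≤ wcross 0 0` number `6`, those with `1 ≤ wcross 1 1` number `6`, and `2` have
both (counting measure on the `⊤` σ-algebra). [folklore] -/
theorem stub_boxCensus :
    ∀ Ω : Set ℂ, (∀ x y : Site 2, (discreteDomainGraph Ω 1).Adj x y ↔
        (zdGraph 2).Adj x y ∧ x ∈ boxSites ![0, 0] ![2, 2] ∧ y ∈ boxSites ![0, 0] ![2, 2]) →
      Measure.count {γ : SAW.DomainSAW Ω 1 (bx 0 0) (bx 2 2) | 1 ≤ wcross 0 0 γ.walk} = 6 ∧
      Measure.count {γ : SAW.DomainSAW Ω 1 (bx 0 0) (bx 2 2) | 1 ≤ wcross 1 1 γ.walk} = 6 ∧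
      Measure.count (Set.univ : Set (SAW.DomainSAW Ω 1 (bx 0 0) (bx 2 2))) = 12 ∧
      Measure.count ({γ : SAW.DomainSAW Ω 1 (bx 0 0) (bx 2 2) | 1 ≤ wcross 0 0 γ.walk} ∩
        {γ | 1 ≤ wcross 1 1 γ.walk}) = 2 := by
  intro Ω hB
  obtain ⟨-, cU, cA, cB, cAB⟩ := census₃
  refine ⟨?_, ?_, ?_, ?_⟩
  · exact count_eq_of_boxAdj hB (fun s => decide (1 ≤ pathCross 0 0 (bx 0 0) s.tail)) _
      (fun γ => by rw [decide_eq_true_iff]; exact Iff.rfl) cA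
  · exact count_eq_of_boxAdj hB (fun s => decide (1 ≤ pathCross 1 1 (bx 0 0) s.tail)) _
      (fun γ => by rw [decide_eq_true_iff]; exact Iff.rfl) cB
  · exact count_eq_of_boxAdj hB (fun _ => true) _ (fun γ => by simp) cU
  · exact count_eq_of_boxAdj hB (fun s => decide (1 ≤ pathCross 0 0 (bx 0 0) s.tail) &&
        decide (1 ≤ pathCross 1 1 (bx 0 0) s.tail)) _
      (fun γ => by rw [Bool.and_eq_true, decide_eq_true_iff, decide_eq_true_iff]; exact Iff.rfl) cAB

end Summit.CriticalPhenomena.SAWScalingLimit.Theorems.NotFKGAtOne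

end
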